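import Summits.CriticalPhenomena.Ising3DConformalLimit.Theorems.ArmHyperscalingOneArmHyperscalingFaceCoreIff
import Literature.Probability.LatticeModels.CriticalUrsellFourSign
import Literature.Probability.LatticeModels.CriticalFKIsingBoxCrossingLower
import HarnessLib

/-!
# `FaceSaturation` = crux ⊕ tightness of the mirror Cauchy–Schwarz inequality (line `mirror-face-saturation`,
crux stmt-CriticalPhenomena-15591; lead prover-line-stmt-CriticalPhenomena-15591-0, 2026-08-17)

The line's open core `FaceSaturation` (SAT: `F ≤ C·T/√S`) implies the crux (`OneArmHyperscaling_of_faceSaturation`, landed).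
This file records the exact converse gap (STRATEGY-CENSUS S1: "SAT is stronger than OA by the CS-saturation gap"): if the mirror
Cauchy–Schwarz inequality `T² ≤ ⟨σ₀σ_{2ne₀}⟩·S` (landed `stub_mirrorCauchySchwarz`) is TIGHT up to a constant at every ratio
`K ≥ 2` — `⟨σ₀σ_{2ne₀}⟩·S ≤ C_K·T²` for all `n ≥ 1` — then the crux implies SAT (`faceSaturation_of_crux_of_tight`, registered
glue sub-goal).  So, modulo tightness, SAT ⟺ crux.  Monte Carlo (lead's job j026127, K = 2, ℓ = 4…12):
`T²/(⟨σ₀σ_{2ne₀}⟩S) = 0.82 → 0.88`, i.e. the OS vectors `[σ_x]` and `[M_A]` are nearly parallel (cos ≈ 0.92); tightness itself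
is an OPEN two-point regularity statement (a doubling-type comparison across the ratio `K`), a hypothesis here, not a claim.
Also recorded: `mirrorGram_pos` (`S > 0`, every critical two-point value is positive on `ℤ³`) and `faceResponse_nonneg`.
-/

noncomputable section

namespace Summit.CriticalPhenomena.Ising3DConformalLimit.Cruxes.OneArmHyperscaling.MirrorFaceSaturation

open Literature.Probability.LatticeModels Finset

/-- `0 ≤ faceResponse K n` (a sum of critical two-point functions; Griffiths I). -/
theorem faceResponse_nonneg (K n : ℕ) : 0 ≤ faceResponse K n :=
  Finset.sum_nonneg fun _ _ => criticalCorr_two_nonneg _ _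

/-- The centre `(n − Kn − 1, 0, 0)` of the face lies on `facePatch K n` (so the face is nonempty). -/
theorem facePatch_nonempty (K n : ℕ) : (facePatch K n).Nonempty := by
  refine ⟨fun i : Fin 3 => if i = 0 then (n : ℤ) - ((K * n : ℕ) : ℤ) - 1 else 0, ?_⟩
  rw [facePatch, Fintype.mem_piFinset]
  intro i
  fin_cases i <;> simp <;> positivity

/-- The centre `(Kn + 1 − n, 0, 0)` of the mirror patch lies on `mirrorPatch K n` (so it is nonempty). -/
theorem mirrorPatch_nonempty (K n : ℕ) : (mirrorPatch K n).Nonempty := by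
  refine ⟨fun i : Fin 3 => if i = 0 then ((K * n : ℕ) : ℤ) + 1 - (n : ℤ) else 0, ?_⟩
  rw [mirrorPatch, Fintype.mem_piFinset]
  intro i
  fin_cases i <;> simp <;> positivity

/-- `0 < mirrorGram K n`: every critical two-point value on `ℤ³` is strictly positive
(`criticalTwoPoint_pos_of_three_le`) and both patches are nonempty. -/
theorem mirrorGram_pos (K n : ℕ) : 0 < mirrorGram K n := by
  refine Finset.sum_pos (fun _ _ => Finset.sum_pos (fun _ _ => ?_) (facePatch_nonempty K n))
    (mirrorPatch_nonempty K n)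
  rw [criticalCorr_two_pair]
  exact criticalTwoPoint_pos_of_three_le le_rfl _

/-- **SAT from the crux and CS-tightness** (registered glue sub-goal `faceSaturation_of_crux_of_tight`): if at every ratio
`K ≥ 2` the mirror Cauchy–Schwarz inequality is saturated up to a constant, `⟨σ₀σ_{2ne₀}⟩ · mirrorGram K n ≤ C_K · (faceResponse K n)²`
for all `n ≥ 1`, then `OneArmHyperscaling → FaceSaturation`.  Proof: the crux gives `F² ≤ C·⟨σ₀σ_{2ne₀}⟩` at some `K ≥ 2`
(`oneArmHyperscaling_iff_face`), tightness gives `⟨σ₀σ_{2ne₀}⟩ ≤ C_K T²/S` (`S > 0`), so `F ≤ √(C C_K)·T/√S`. -/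
theorem faceSaturation_of_crux_of_tight :
    (∀ K : ℕ, 2 ≤ K → ∃ C : ℝ, ∀ n : ℕ, 1 ≤ n →
        criticalTwoPoint 3 (Pi.single 0 (2 * (n : ℤ))) * mirrorGram K n ≤ C * faceResponse K n ^ 2) →
      Summit.CriticalPhenomena.Ising3DConformalLimit.Theses.ArmHyperscaling.OneArmHyperscaling → FaceSaturation := by
  intro hT hOA
  obtain ⟨K, hK, C, hC⟩ := oneArmHyperscaling_iff_face.1 hOA
  obtain ⟨D, hD⟩ := hT K hK
  refine ⟨K, hK, Real.sqrt (max C 0 * max D 0), fun n hn => ?_⟩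
  have hF2 := hC n hn
  have hDn := hD n hn
  obtain ⟨hm0, hm⟩ := faceSubadditivity_proof K n hK hn
  have hS := mirrorGram_pos K n
  have hT0 := faceResponse_nonneg K n
  have hG0 : 0 ≤ criticalTwoPoint 3 (Pi.single 0 (2 * (n : ℤ))) := criticalTwoPoint_nonneg' _
  have hF0 : 0 ≤ faceMag K n := by linarith
  generalize hFd : faceMag K n = F at *
  generalize hTd : faceResponse K n = T at *
  generalize hSd : mirrorGram K n = S at *
  generalize hGd : criticalTwoPoint 3 (Pi.single 0 (2 * (n : ℤ))) = G at *
  -- nonnegative constants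
  have hF2' : F ^ 2 ≤ max C 0 * G := le_trans hF2 (mul_le_mul_of_nonneg_right (le_max_left _ _) hG0)
  have hDn' : G * S ≤ max D 0 * T ^ 2 := le_trans hDn (mul_le_mul_of_nonneg_right (le_max_left _ _) (sq_nonneg _))
  -- `F² ≤ C' D' T²/S`
  have hkey : F ^ 2 ≤ max C 0 * max D 0 * T ^ 2 / S := by
    have h1 : G ≤ max D 0 * T ^ 2 / S := by rw [le_div_iff₀ hS]; linarith
    calc F ^ 2 ≤ max C 0 * G := hF2'
      _ ≤ max C 0 * (max D 0 * T ^ 2 / S) := mul_le_mul_of_nonneg_left h1 (le_max_right _ _)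
      _ = max C 0 * max D 0 * T ^ 2 / S := by ring
  -- take square roots
  have hrhs : Real.sqrt (max C 0 * max D 0 * T ^ 2 / S) = Real.sqrt (max C 0 * max D 0) * T / Real.sqrt S := by
    rw [Real.sqrt_div (by positivity), Real.sqrt_mul (by positivity), Real.sqrt_sq hT0]
  calc F = Real.sqrt (F ^ 2) := (Real.sqrt_sq hF0).symm
    _ ≤ Real.sqrt (max C 0 * max D 0 * T ^ 2 / S) := Real.sqrt_le_sqrt hkey
    _ = Real.sqrt (max C 0 * max D 0) * T / Real.sqrt S := hrhs

end Summit.CriticalPhenomena.Ising3DConformalLimit.Cruxes.OneArmHyperscaling.MirrorFaceSaturation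

end
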